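import Mathlib
import HarnessLib

/-!
# K3 gen-8-FLOW (stmt 20437 `KLRegimeEngineV17F2`, stub (C), door (B)): the PIECE-TABLE ARITHMETIC — the fit `hfit` and the table `hJ` of
# `moment_selfEnergy_flowStep_sub_le` from GEOMETRIC piece tables `pj m j ≤ A_j · 4^{(j−2)m}`

Cell gate-hubbard-kl, seat p2 g12.  Door (B) on the flow frames (`…EngineFrameShiftMomentDoorFlow`, p545976; position form
`…EngineFrameShiftMomentDoorFlowPosition`) carries two arithmetic side conditions on the piece jet tables `pj m j ≥ ‖Dʲ evalM (klFlowPiece m)‖`: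

  `hfit : ∀ j, 1 ≤ j → j ≤ r+2 → 4 + Σ_{m<n} pj m j + pj n j ≤ d · X^{j−1}`,   `X = 6/m_ω`, `m_ω = max(|ω_i|, Λ/2)`,
  `hJ   : ∀ k ≤ r+2, (π/2)^k Σ_{j ≤ k} C(k,j)·(j!·(2βL²·B·(2/m_ω)²·j!)·(max d 1 · X)^j)·pj n (k−j) ≤ J`.

The history supplies the tables in GEOMETRIC form `pj m j ≤ A_j · 4^{(j−2)m}` — `(I-F jets)` `FlowPieceJetsAt` for `j ≤ 4` (`A_j = R.Gfr j · uPow j U`) and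
`…FlowPieceJetsAllOrders.norm_iteratedFDeriv_evalM_jacksonFrame_klFrameExtFn_le_all` at `d = klFlowDeg m` for `j = 5, 6` — and at the reading frequencies `±ω₀`
one has `4^n ≤ X ≤ X₁·4^n` (`Λ = Λ_n = 4^{−n}/32`; `4^{n} ≤ 6β/π` for `n ≤ n_β + 1`).  This file is the pure real arithmetic turning the geometric
tables into the two side conditions with EXPLICIT `d` and `J`:

* `zpow_sub_two_mul_le` — `4^{(j−2)m} ≤ (4^n)^{j−1}·(1/4)^m` for `1 ≤ j`, `m ≤ n`; `sum_range_inv_four_pow_le` — `Σ_{m ≤ n} (1/4)^m ≤ 4/3`;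
* **`flowStep_fit_of_geometric_tables`** — `hfit` with `d := 4 + 2·Σ_{j' ≤ r+2} A_{j'}` from `4^n ≤ X`;
* `flowStep_table_term_le` — one term of `hJ` against `A_{k−j}·4^{kn}`;
* **`flowStep_table_of_geometric_tables`** — `hJ` with
  `J := (2βL²·B·X₁²/9) · (Σ_{k ≤ r+2} (π/2)^k Σ_{j ≤ k} C(k,j)·j!²·(max d 1·X₁)^j·A_{k−j}) · 4^{(r+2)n}` from `X ≤ X₁·4^n`.

Pure arithmetic; no model content; nothing asserts superconductivity.
-/

noncomputable section

namespace Summit.HubbardSuperconductivity.HubbardSuperconductivity.Theorems.EngineV8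

set_option linter.dupNamespace false -- summit = problem name (single-conjunct summit), D-0017

open Finset
open scoped Nat

/-! ## §1 Geometric sums of the piece law -/

/-- The piece law against the last scale: `4^{(j−2)m} ≤ (4^n)^{j−1} · (1/4)^m` for `1 ≤ j` and `m ≤ n`. -/
theorem zpow_sub_two_mul_le {j m n : ℕ} (hj : 1 ≤ j) (hm : m ≤ n) :
    (4 : ℝ) ^ (((j : ℤ) - 2) * m) ≤ ((4 : ℝ) ^ n) ^ (j - 1) * ((4 : ℝ)⁻¹) ^ m := by
  have h4 : (4 : ℝ) ≠ 0 := by norm_num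
  have hsplit : ((j : ℤ) - 2) * m = (((j - 1) * m : ℕ) : ℤ) - (m : ℤ) := by
    push_cast [Nat.cast_sub hj]
    ring
  rw [hsplit, zpow_sub₀ h4, zpow_natCast, zpow_natCast, inv_pow, div_eq_mul_inv]
  refine mul_le_mul_of_nonneg_right ?_ (by positivity)
  rw [mul_comm, pow_mul]
  exact pow_le_pow_left₀ (by positivity) (pow_le_pow_right₀ (by norm_num) hm) _

/-- `Σ_{m ≤ n} (1/4)^m ≤ 4/3`. -/
theorem sum_range_inv_four_pow_le (n : ℕ) : ∑ m ∈ range (n + 1), ((4 : ℝ)⁻¹) ^ m ≤ 4 / 3 := by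
  have h := geom_sum_Ico_le_of_lt_one (show (0 : ℝ) ≤ 4⁻¹ by norm_num) (show (4 : ℝ)⁻¹ < 1 by norm_num) (m := 0) (n := n + 1)
  rw [range_eq_Ico]
  refine h.trans (le_of_eq ?_)
  norm_num

/-! ## §2 The fit `hfit` -/

/-- **THE FIT FROM GEOMETRIC TABLES**: if `pj m j ≤ A_j·4^{(j−2)m}` for `m ≤ n`, `j ≤ r+2` (`A ≥ 0`) and `4^n ≤ X`, then for `1 ≤ j ≤ r+2`
`4 + Σ_{m<n} pj m j + pj n j ≤ (4 + 2·Σ_{j' ≤ r+2} A_{j'}) · X^{j−1}`. -/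
theorem flowStep_fit_of_geometric_tables {n r : ℕ} {pj : ℕ → ℕ → ℝ} {A : ℕ → ℝ} (hA : ∀ j, 0 ≤ A j)
    (hpjA : ∀ m ≤ n, ∀ j ≤ r + 2, pj m j ≤ A j * (4 : ℝ) ^ (((j : ℤ) - 2) * m)) {X : ℝ} (hX : (4 : ℝ) ^ n ≤ X) :
    ∀ j, 1 ≤ j → j ≤ r + 2 → 4 + ∑ m ∈ range n, pj m j + pj n j ≤ (4 + 2 * ∑ j' ∈ range (r + 3), A j') * X ^ (j - 1) := by
  intro j hj1 hj
  have h4n : (0 : ℝ) < (4 : ℝ) ^ n := by positivity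
  have hX1 : 1 ≤ X := le_trans (one_le_pow₀ (by norm_num)) hX
  have hXj : ((4 : ℝ) ^ n) ^ (j - 1) ≤ X ^ (j - 1) := pow_le_pow_left₀ h4n.le hX _
  have hXj1 : 1 ≤ X ^ (j - 1) := one_le_pow₀ hX1
  have hterm : ∀ m ∈ range (n + 1), pj m j ≤ A j * (((4 : ℝ) ^ n) ^ (j - 1) * ((4 : ℝ)⁻¹) ^ m) := by
    intro m hm
    have hmn : m ≤ n := Nat.lt_succ_iff.mp (mem_range.mp hm)
    exact (hpjA m hmn j hj).trans (mul_le_mul_of_nonneg_left (zpow_sub_two_mul_le hj1 hmn) (hA j))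
  have h1 : ∑ m ∈ range (n + 1), pj m j ≤ A j * ((4 : ℝ) ^ n) ^ (j - 1) * (4 / 3) := by
    calc ∑ m ∈ range (n + 1), pj m j ≤ ∑ m ∈ range (n + 1), A j * (((4 : ℝ) ^ n) ^ (j - 1) * ((4 : ℝ)⁻¹) ^ m) := sum_le_sum hterm
      _ = A j * ((4 : ℝ) ^ n) ^ (j - 1) * ∑ m ∈ range (n + 1), ((4 : ℝ)⁻¹) ^ m := by
          rw [mul_sum]
          exact sum_congr rfl fun m _ => by ring
      _ ≤ A j * ((4 : ℝ) ^ n) ^ (j - 1) * (4 / 3) :=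
          mul_le_mul_of_nonneg_left (sum_range_inv_four_pow_le n) (mul_nonneg (hA j) (by positivity))
  have hAj : A j ≤ ∑ j' ∈ range (r + 3), A j' := single_le_sum (fun j' _ => hA j') (mem_range.mpr (by omega))
  have hsucc : 4 + ∑ m ∈ range n, pj m j + pj n j = 4 + ∑ m ∈ range (n + 1), pj m j := by
    rw [sum_range_succ]; ring
  rw [hsucc]
  have h2 : A j * ((4 : ℝ) ^ n) ^ (j - 1) * (4 / 3) ≤ A j * X ^ (j - 1) * (4 / 3) :=
    mul_le_mul_of_nonneg_right (mul_le_mul_of_nonneg_left hXj (hA j)) (by norm_num)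
  have h3 : 0 ≤ (2 * ∑ j' ∈ range (r + 3), A j' - 4 / 3 * A j) * X ^ (j - 1) :=
    mul_nonneg (by linarith [hA j]) (by positivity)
  nlinarith [h1, h2, h3, hXj1]

/-! ## §3 The table `hJ` -/

/-- Collecting the powers of `4`: `(4^n)² · (4^n)^j · 4^{((k−j)−2)n} = 4^{kn}` for `j ≤ k`. -/
theorem four_pow_collect {n k j : ℕ} (hjk : j ≤ k) :
    ((4 : ℝ) ^ n) ^ 2 * ((4 : ℝ) ^ n) ^ j * (4 : ℝ) ^ ((((k - j : ℕ) : ℤ) - 2) * n) = (4 : ℝ) ^ (k * n) := by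
  have h4 : (4 : ℝ) ≠ 0 := by norm_num
  rw [← pow_mul, ← pow_mul, ← pow_add, ← zpow_natCast, ← zpow_natCast (4 : ℝ) (k * n), ← zpow_add₀ h4]
  congr 1
  push_cast [Nat.cast_sub hjk]
  ring

/-- A coefficient comparison with a possibly negative datum: `0 ≤ c ≤ c'`, `p ≤ a`, `0 ≤ a` give `c·p ≤ c'·a`. -/
theorem mul_le_mul_of_le_of_le_nonneg {c c' p a : ℝ} (hc : 0 ≤ c) (hcc' : c ≤ c') (hp : p ≤ a) (ha : 0 ≤ a) : c * p ≤ c' * a :=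
  (mul_le_mul_of_nonneg_left hp hc).trans (mul_le_mul_of_nonneg_right hcc' ha)

/-- **ONE TERM OF THE TABLE**: for `j ≤ k`, `p ≤ A_{k−j}·4^{((k−j)−2)n}`, `6/m_ω ≤ X₁·4^n`:
`C(k,j)·(j!·(2V·B·(2/m_ω)²·j!)·(max d 1·6/m_ω)^j)·p ≤ (C(k,j)·j!²·(max d 1·X₁)^j·A_{k−j}) · (2V·B·X₁²/9) · 4^{kn}`. -/
theorem flowStep_table_term_le {n k j : ℕ} (hjk : j ≤ k) {A : ℕ → ℝ} (hA : ∀ i, 0 ≤ A i) {p : ℝ}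
    (hp : p ≤ A (k - j) * (4 : ℝ) ^ ((((k - j : ℕ) : ℤ) - 2) * n)) {V B d mω X₁ : ℝ} (hV : 0 ≤ V) (hB : 0 ≤ B) (hmω : 0 < mω)
    (hhi : 6 / mω ≤ X₁ * (4 : ℝ) ^ n) :
    (k.choose j : ℝ) * (j ! * ((2 * V * B * (2 / mω) ^ 2) * j !) * (max d 1 * (6 / mω)) ^ j) * p ≤
      ((k.choose j : ℝ) * ((j ! : ℝ) * j !) * (max d 1 * X₁) ^ j * A (k - j)) * (2 * V * B * X₁ ^ 2 / 9) * (4 : ℝ) ^ (k * n) := by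
  have h6 : 0 ≤ 6 / mω := by positivity
  have hX₁n : 0 ≤ X₁ * (4 : ℝ) ^ n := h6.trans hhi
  have hd : 0 ≤ max d 1 := le_trans zero_le_one (le_max_right _ _)
  have hsq : (2 / mω) ^ 2 ≤ (X₁ * (4 : ℝ) ^ n) ^ 2 / 9 := by
    have : (2 / mω) ^ 2 = (6 / mω) ^ 2 / 9 := by ring
    rw [this]
    exact div_le_div_of_nonneg_right (pow_le_pow_left₀ h6 hhi 2) (by norm_num)
  have hpow : (max d 1 * (6 / mω)) ^ j ≤ (max d 1 * (X₁ * (4 : ℝ) ^ n)) ^ j :=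
    pow_le_pow_left₀ (mul_nonneg hd h6) (mul_le_mul_of_nonneg_left hhi hd) j
  have ha : 0 ≤ A (k - j) * (4 : ℝ) ^ ((((k - j : ℕ) : ℤ) - 2) * n) := mul_nonneg (hA _) (zpow_nonneg (by norm_num) _)
  have hc : 0 ≤ (k.choose j : ℝ) * (j ! * ((2 * V * B * (2 / mω) ^ 2) * j !) * (max d 1 * (6 / mω)) ^ j) := by positivity
  have hcc' : (k.choose j : ℝ) * (j ! * ((2 * V * B * (2 / mω) ^ 2) * j !) * (max d 1 * (6 / mω)) ^ j) ≤
      (k.choose j : ℝ) * (j ! * ((2 * V * B * ((X₁ * (4 : ℝ) ^ n) ^ 2 / 9)) * j !) * (max d 1 * (X₁ * (4 : ℝ) ^ n)) ^ j) := by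
    gcongr
  refine (mul_le_mul_of_le_of_le_nonneg hc hcc' hp ha).trans (le_of_eq ?_)
  rw [← four_pow_collect hjk]
  ring

/-- **THE TABLE FROM GEOMETRIC TABLES**: if `pj n k ≤ A_k·4^{(k−2)n}` for `k ≤ r+2` (`A ≥ 0`) and `6/m_ω ≤ X₁·4^n`, then for every `k ≤ r+2`
the `k`-th table expression of door (B) is at most
`J := (2V·B·X₁²/9) · (Σ_{k' ≤ r+2} (π/2)^{k'} Σ_{j ≤ k'} C(k',j)·j!²·(max d 1·X₁)^j·A_{k'−j}) · 4^{(r+2)n}` (`V = βL²` in the door). -/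
theorem flowStep_table_of_geometric_tables {n r : ℕ} {pj : ℕ → ℕ → ℝ} {A : ℕ → ℝ} (hA : ∀ j, 0 ≤ A j)
    (hpjn : ∀ k ≤ r + 2, pj n k ≤ A k * (4 : ℝ) ^ (((k : ℤ) - 2) * n)) {V B d mω X₁ : ℝ} (hV : 0 ≤ V) (hB : 0 ≤ B) (hmω : 0 < mω)
    (hhi : 6 / mω ≤ X₁ * (4 : ℝ) ^ n) :
    ∀ k ≤ r + 2, (Real.pi / 2) ^ k * ∑ j ∈ Finset.range (k + 1), (k.choose j : ℝ) *
        (j ! * ((2 * V * B * (2 / mω) ^ 2) * j !) * (max d 1 * (6 / mω)) ^ j) * pj n (k - j) ≤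
      (2 * V * B * X₁ ^ 2 / 9) * (∑ k' ∈ Finset.range (r + 3), (Real.pi / 2) ^ k' * ∑ j ∈ Finset.range (k' + 1),
        (k'.choose j : ℝ) * ((j ! : ℝ) * j !) * (max d 1 * X₁) ^ j * A (k' - j)) * (4 : ℝ) ^ ((r + 2) * n) := by
  intro k hk
  have h6 : 0 ≤ 6 / mω := by positivity
  have hX₁n : 0 ≤ X₁ * (4 : ℝ) ^ n := h6.trans hhi
  have hX₁ : 0 ≤ X₁ := le_of_mul_le_mul_right (by rwa [zero_mul]) (by positivity : (0 : ℝ) < (4 : ℝ) ^ n)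
  have hd : 0 ≤ max d 1 := le_trans zero_le_one (le_max_right _ _)
  -- the coefficient sums are nonnegative
  set T : ℕ → ℝ := fun k' => (Real.pi / 2) ^ k' * ∑ j ∈ Finset.range (k' + 1),
    (k'.choose j : ℝ) * ((j ! : ℝ) * j !) * (max d 1 * X₁) ^ j * A (k' - j) with hT
  have hT0 : ∀ k', 0 ≤ T k' := fun k' => by
    rw [hT]
    exact mul_nonneg (by positivity) (sum_nonneg fun j _ => by
      exact mul_nonneg (mul_nonneg (by positivity) (pow_nonneg (mul_nonneg hd hX₁) _)) (hA _))
  -- termwise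
  have hterm : ∀ j ∈ Finset.range (k + 1), (k.choose j : ℝ) *
      (j ! * ((2 * V * B * (2 / mω) ^ 2) * j !) * (max d 1 * (6 / mω)) ^ j) * pj n (k - j) ≤
      ((k.choose j : ℝ) * ((j ! : ℝ) * j !) * (max d 1 * X₁) ^ j * A (k - j)) * (2 * V * B * X₁ ^ 2 / 9) * (4 : ℝ) ^ (k * n) := by
    intro j hj
    have hjk : j ≤ k := Nat.lt_succ_iff.mp (mem_range.mp hj)
    have hp := hpjn (k - j) (by omega)
    exact flowStep_table_term_le hjk hA hp hV hB hmω hhi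
  have hsum : (Real.pi / 2) ^ k * ∑ j ∈ Finset.range (k + 1), (k.choose j : ℝ) *
      (j ! * ((2 * V * B * (2 / mω) ^ 2) * j !) * (max d 1 * (6 / mω)) ^ j) * pj n (k - j) ≤
      T k * (2 * V * B * X₁ ^ 2 / 9) * (4 : ℝ) ^ (k * n) := by
    calc (Real.pi / 2) ^ k * ∑ j ∈ Finset.range (k + 1), (k.choose j : ℝ) *
          (j ! * ((2 * V * B * (2 / mω) ^ 2) * j !) * (max d 1 * (6 / mω)) ^ j) * pj n (k - j)
        ≤ (Real.pi / 2) ^ k * ∑ j ∈ Finset.range (k + 1),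
            ((k.choose j : ℝ) * ((j ! : ℝ) * j !) * (max d 1 * X₁) ^ j * A (k - j)) * (2 * V * B * X₁ ^ 2 / 9) * (4 : ℝ) ^ (k * n) :=
          mul_le_mul_of_nonneg_left (sum_le_sum hterm) (by positivity)
      _ = T k * (2 * V * B * X₁ ^ 2 / 9) * (4 : ℝ) ^ (k * n) := by
          rw [hT, ← sum_mul, ← sum_mul]
          ring
  -- the scale power and the single term against the sum
  have hpow : (4 : ℝ) ^ (k * n) ≤ (4 : ℝ) ^ ((r + 2) * n) :=
    pow_le_pow_right₀ (by norm_num) (Nat.mul_le_mul_right n hk)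
  have hTk : T k ≤ ∑ k' ∈ Finset.range (r + 3), T k' := single_le_sum (fun k' _ => hT0 k') (mem_range.mpr (by omega))
  have hc : 0 ≤ 2 * V * B * X₁ ^ 2 / 9 := by positivity
  calc _ ≤ T k * (2 * V * B * X₁ ^ 2 / 9) * (4 : ℝ) ^ (k * n) := hsum
    _ ≤ (∑ k' ∈ Finset.range (r + 3), T k') * (2 * V * B * X₁ ^ 2 / 9) * (4 : ℝ) ^ ((r + 2) * n) := by
        have h0 : 0 ≤ (∑ k' ∈ Finset.range (r + 3), T k') * (2 * V * B * X₁ ^ 2 / 9) :=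
          mul_nonneg (sum_nonneg fun k' _ => hT0 k') hc
        exact mul_le_mul (mul_le_mul_of_nonneg_right hTk hc) hpow (by positivity) h0
    _ = _ := by rw [hT]; ring

end Summit.HubbardSuperconductivity.HubbardSuperconductivity.Theorems.EngineV8

end
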